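import Summits.Parity.GeneralizedHardyLittlewood.Theorems.Dhl42DefsRegions
import Literature.NumberTheory.Sieve.PolymathMkEpsJ

/-!
# DHL[42,2] certificate — measurability, boundedness, integrability of `F₀`, `F₀²`, sections, `(F₀)₁`

The domain facts for `B·R_n` are the tree's (`isClosed_scaledSimplex`, `measurableSet_scaledSimplex`
of `PolymathBoundedGaps`; `isCompact_scaledSimplex`, `volume_scaledSimplex_lt_top`,
`apply_mem_Icc_of_mem_scaledSimplex`, `scaledSimplex_subset_Icc` of `PolymathMkEpsJ`); §B
measurability of `F₀` (the profiles `g`, `h`, the marked factor `R` are continuous, `Φ`, `χ` are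
continuous pieces cut at `s ≤ K`); §C boundedness of `F₀` (`exists_bound_F0`, via the continuous
majorant `F0maj` on the compact simplex); §D integrability of `F₀`, `F₀²`, of every section
`s ↦ F₀(s, t')`, strong measurability, boundedness and integrability of the marginal
`F0marg = (F₀)₁` and of the integrands of `Ival`, `JKval`, `LGval` (eqs. (14)–(16)). NOT here: the
cross-term integrands on the cover members (→ `Dhl42IntegrabilityCover`).

Origin: `Dhl42/Integrability.lean` of the DHL[42,2] certificate package (pub-dhl42 bundle, archive
blob `18cce9e3`; sha256[:16] of the file `f2fc1acc19a920b3`; paper snapshot = `paper/main.tex` v1),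
lines :74–:302; statements and proofs unchanged except: namespace `TpY4Dhl42` →
`Summit.Parity.GeneralizedHardyLittlewood.Theorems.Dhl42`, the package's `simplexSet n B` replaced
by the tree's definitionally equal `Literature.NumberTheory.Sieve.scaledSimplex n B` (also inside
declaration names), docstrings added where missing, `#print axioms` lines dropped; §A (:44–:72:
`simplexSet_eq`, `isClosed_simplexSet`, `measurableSet_simplexSet`,
`apply_mem_Icc_of_mem_simplexSet`, `simplexSet_subset_Icc`, `isCompact_simplexSet`,
`volume_simplexSet_lt_top`) dropped for the tree lemmas of the same names over `scaledSimplex`.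
Package-internal references in the verbatim docstrings (`Dhl42/….lean`, `Assumed.…`, `row 9…`,
`gen n`, `inputs/COMPARE.md`) refer to that package (paper Appendix B).

Declarations (43): `continuous_gfun`, `continuous_hfun`, `continuous_Rmark`, `PhiPoly`, `PhiCut`,
`chiPoly`, `continuous_PhiPoly`, `continuous_PhiCut`, `continuous_chiPoly`, `Phi_eq`, `chi_eq`,
`measurable_Phi`, `measurable_chi`, `abs_Phi_le`, `abs_chi_le`, `F0core`, `F0_eq_indicator`,
`measurable_sum_coord`, `continuous_prod_gfun`, `measurable_F0core`, `measurable_F0`,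
`stronglyMeasurable_F0`, `F0maj`, `continuous_F0maj`, `prod_gfun_pos`, `abs_F0core_le`,
`exists_bound_F0`, `F0_eq_zero_of_not_mem`, `volume_simplex42_ne_top`, `integrable_F0`,
`integrable_F0_sq`, `Ival_eq_setIntegral`, `continuous_consMap`, `mem_Icc_of_cons_mem`,
`F0_cons_eq_zero`, `integrable_F0_cons`, `stronglyMeasurable_F0marg`, `measurable_F0marg`, `Sc_pos`,
`exists_bound_F0marg`, `integrableOn_F0marg_sq`, `integrableOn_JKval`, `integrableOn_LGval`.
-/

open MeasureTheory Set
open Literature.NumberTheory.Sieve (scaledSimplex measurableSet_scaledSimplex apply_mem_Icc_of_mem_scaledSimplex isCompact_scaledSimplex volume_scaledSimplex_lt_top)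

namespace Summit.Parity.GeneralizedHardyLittlewood.Theorems.Dhl42

noncomputable section

/-! ### B. Measurability of the trial function `F0` -/

/-- The profile `g` of the trial function (Section 7.2) is continuous. -/
theorem continuous_gfun : Continuous gfun := by
  unfold gfun; fun_prop

/-- The marked profile `h` (Section 7.2) is continuous. -/
theorem continuous_hfun : Continuous hfun := by
  unfold hfun; fun_prop

/-- The marked factor `R(t) = Σ_l h(t_l)/g(t_l)` (Section 7.2) is continuous (`g > 0`). -/
theorem continuous_Rmark : Continuous Rmark := by
  unfold Rmark
  exact continuous_finsetSum _ fun l _ =>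
    (continuous_hfun.comp (continuous_apply l)).div (continuous_gfun.comp (continuous_apply l))
      fun t => (gfun_pos (t l)).ne'

/-- The polynomial part `Σ_a c_a (S - s)^a` of `Φ`. -/
def PhiPoly (s : ℝ) : ℝ := ∑ a : Fin 8, cvec a * (Sc - s) ^ (a : ℕ)

/-- The cut-off part `Σ_a c'_a (K - s)^a` of `Φ` (before the cut-off at `s ≤ K`). -/
def PhiCut (s : ℝ) : ℝ := ∑ a : Fin 3, cpvec a * (Kc - s) ^ (a : ℕ)

/-- The polynomial `Σ_a d_a (K - s)^a` of `χ` (before the cut-off at `s ≤ K`). -/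
def chiPoly (s : ℝ) : ℝ := ∑ a : Fin 9, dvec a * (Kc - s) ^ (a : ℕ)

/-- `PhiPoly` (a polynomial in `S − s`) is continuous. -/
theorem continuous_PhiPoly : Continuous PhiPoly := by unfold PhiPoly; fun_prop
/-- `PhiCut` (a polynomial in `K − s`) is continuous. -/
theorem continuous_PhiCut : Continuous PhiCut := by unfold PhiCut; fun_prop
/-- `chiPoly` (a polynomial in `K − s`) is continuous. -/
theorem continuous_chiPoly : Continuous chiPoly := by unfold chiPoly; fun_prop

/-- `Φ(s) = PhiPoly s + 1_{s ≤ K} · PhiCut s` (definitional unfolding of `Phi`). -/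
theorem Phi_eq (s : ℝ) : Phi s = PhiPoly s + if s ≤ Kc then PhiCut s else 0 := rfl

/-- `χ(s) = 1_{s ≤ K} · chiPoly s` (definitional unfolding of `chi`). -/
theorem chi_eq (s : ℝ) : chi s = if s ≤ Kc then chiPoly s else 0 := rfl

/-- `Φ` is measurable (continuous pieces glued along the cut `s ≤ K`). -/
theorem measurable_Phi : Measurable Phi := by
  have h : Measurable fun s : ℝ => if s ≤ Kc then PhiCut s else 0 :=
    Measurable.ite (measurableSet_le measurable_id measurable_const) continuous_PhiCut.measurable
      measurable_const
  have e : Phi = fun s => PhiPoly s + if s ≤ Kc then PhiCut s else 0 := funext Phi_eq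
  rw [e]
  exact continuous_PhiPoly.measurable.add h

/-- `χ` is measurable (a continuous piece cut off at `s ≤ K`). -/
theorem measurable_chi : Measurable chi := by
  have h : Measurable fun s : ℝ => if s ≤ Kc then chiPoly s else 0 :=
    Measurable.ite (measurableSet_le measurable_id measurable_const) continuous_chiPoly.measurable
      measurable_const
  have e : chi = fun s => if s ≤ Kc then chiPoly s else 0 := funext chi_eq
  rw [e]
  exact h

/-- `|Φ(s)| ≤ |PhiPoly s| + |PhiCut s|`. -/
theorem abs_Phi_le (s : ℝ) : |Phi s| ≤ |PhiPoly s| + |PhiCut s| := by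
  rw [Phi_eq]
  split_ifs
  · exact abs_add_le _ _
  · simp

/-- `|χ(s)| ≤ |chiPoly s|`. -/
theorem abs_chi_le (s : ℝ) : |chi s| ≤ |chiPoly s| := by
  rw [chi_eq]
  split_ifs
  · exact le_rfl
  · simp

/-- `F0` before restriction to the simplex. -/
def F0core (t : Fin 42 → ℝ) : ℝ :=
  (∏ j, gfun (t j)) * (Phi (∑ j, t j) + chi (∑ j, t j) * Rmark t)

/-- `F₀` is `F0core` restricted to `S·R₄₂` (definitional). -/
theorem F0_eq_indicator : F0 = (scaledSimplex 42 Sc).indicator F0core := rfl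

/-- The coordinate sum `t ↦ Σ_j t_j` on `ℝⁿ` is measurable. -/
theorem measurable_sum_coord (n : ℕ) : Measurable fun t : Fin n → ℝ => ∑ j, t j :=
  Finset.measurable_sum _ fun j _ => measurable_pi_apply j

/-- `t ↦ ∏_j g(t_j)` is continuous on `ℝ⁴²`. -/
theorem continuous_prod_gfun : Continuous fun t : Fin 42 → ℝ => ∏ j, gfun (t j) :=
  continuous_finsetProd _ fun j _ => continuous_gfun.comp (continuous_apply j)

/-- `F0core` is measurable. -/
theorem measurable_F0core : Measurable F0core := by
  unfold F0core
  exact continuous_prod_gfun.measurable.mul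
    ((measurable_Phi.comp (measurable_sum_coord 42)).add
      ((measurable_chi.comp (measurable_sum_coord 42)).mul continuous_Rmark.measurable))

/-- The trial function `F₀` is measurable. -/
theorem measurable_F0 : Measurable F0 := by
  rw [F0_eq_indicator]
  exact measurable_F0core.indicator (measurableSet_scaledSimplex 42 Sc)

/-- The trial function `F₀` is strongly measurable. -/
theorem stronglyMeasurable_F0 : StronglyMeasurable F0 := measurable_F0.stronglyMeasurable

/-! ### C. Boundedness of `F0` -/

/-- A continuous majorant of `|F0core|`. -/
def F0maj (t : Fin 42 → ℝ) : ℝ :=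
  (∏ j, gfun (t j)) *
    (|PhiPoly (∑ j, t j)| + |PhiCut (∑ j, t j)| + |chiPoly (∑ j, t j)| * |Rmark t|)

/-- The majorant `F0maj` of `|F0core|` is continuous. -/
theorem continuous_F0maj : Continuous F0maj := by
  unfold F0maj
  have hs : Continuous fun t : Fin 42 → ℝ => ∑ j, t j :=
    continuous_finsetSum _ fun j _ => continuous_apply j
  exact continuous_prod_gfun.mul
    ((((continuous_PhiPoly.comp hs).abs).add ((continuous_PhiCut.comp hs).abs)).add
      (((continuous_chiPoly.comp hs).abs).mul continuous_Rmark.abs))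

/-- `∏_j g(t_j) > 0`. -/
theorem prod_gfun_pos (t : Fin 42 → ℝ) : 0 < ∏ j, gfun (t j) :=
  Finset.prod_pos fun j _ => gfun_pos (t j)

/-- `|F0core t| ≤ F0maj t` pointwise (triangle inequality; the cut-offs only drop terms). -/
theorem abs_F0core_le (t : Fin 42 → ℝ) : |F0core t| ≤ F0maj t := by
  unfold F0core F0maj
  rw [abs_mul, abs_of_pos (prod_gfun_pos t)]
  refine mul_le_mul_of_nonneg_left ?_ (prod_gfun_pos t).le
  calc |Phi (∑ j, t j) + chi (∑ j, t j) * Rmark t|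
      ≤ |Phi (∑ j, t j)| + |chi (∑ j, t j) * Rmark t| := abs_add_le _ _
    _ = |Phi (∑ j, t j)| + |chi (∑ j, t j)| * |Rmark t| := by rw [abs_mul]
    _ ≤ (|PhiPoly (∑ j, t j)| + |PhiCut (∑ j, t j)|) + |chiPoly (∑ j, t j)| * |Rmark t| :=
        add_le_add (abs_Phi_le _) (mul_le_mul_of_nonneg_right (abs_chi_le _) (abs_nonneg _))

/-- `F0` is bounded: there is `C ≥ 0` with `|F0 t| ≤ C` for all `t`. -/
theorem exists_bound_F0 : ∃ C : ℝ, 0 ≤ C ∧ ∀ t, |F0 t| ≤ C := by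
  obtain ⟨C, hC⟩ := (isCompact_scaledSimplex 42 Sc).exists_bound_of_continuousOn
    continuous_F0maj.continuousOn
  refine ⟨max C 0, le_max_right _ _, fun t => ?_⟩
  rw [F0_eq_indicator]
  by_cases ht : t ∈ scaledSimplex 42 Sc
  · rw [indicator_of_mem ht]
    have h1 := abs_F0core_le t
    have h2 : F0maj t ≤ C := le_trans (le_abs_self _) (by simpa [Real.norm_eq_abs] using hC t ht)
    exact le_trans h1 (le_trans h2 (le_max_left _ _))
  · rw [indicator_of_notMem ht, abs_zero]
    exact le_max_right _ _

/-- `F₀` vanishes off `S·R₄₂`. -/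
theorem F0_eq_zero_of_not_mem {t : Fin 42 → ℝ} (ht : t ∉ scaledSimplex 42 Sc) : F0 t = 0 := by
  rw [F0_eq_indicator, indicator_of_notMem ht]

/-! ### D. Integrability of `F0`, `F0²`, the sections and the marginal -/

/-- `S·R₄₂` has finite measure (the `≠ ⊤` form consumed by the integrability lemmas). -/
theorem volume_simplex42_ne_top : volume (scaledSimplex 42 Sc) ≠ ⊤ :=
  (volume_scaledSimplex_lt_top 42 Sc).ne

/-- `F0` is integrable on `ℝ⁴²`. -/
theorem integrable_F0 : Integrable F0 := by
  obtain ⟨C, -, hC⟩ := exists_bound_F0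
  have hsupp : Function.support F0 ⊆ scaledSimplex 42 Sc :=
    Function.support_subset_iff'.2 fun t ht => F0_eq_zero_of_not_mem ht
  rw [← integrableOn_iff_integrable_of_support_subset hsupp]
  exact Measure.integrableOn_of_bounded volume_simplex42_ne_top
    measurable_F0.aestronglyMeasurable
    (Filter.Eventually.of_forall fun t => by simpa [Real.norm_eq_abs] using hC t)

/-- The integrand of `Ival` is integrable on `ℝ⁴²`. -/
theorem integrable_F0_sq : Integrable fun t => F0 t ^ 2 := by
  obtain ⟨C, hC0, hC⟩ := exists_bound_F0
  have hsupp : Function.support (fun t => F0 t ^ 2) ⊆ scaledSimplex 42 Sc :=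
    Function.support_subset_iff'.2 fun t ht => by simp [F0_eq_zero_of_not_mem ht]
  rw [← integrableOn_iff_integrable_of_support_subset hsupp]
  refine Measure.integrableOn_of_bounded (M := C ^ 2) volume_simplex42_ne_top
    (measurable_F0.pow_const 2).aestronglyMeasurable
    (Filter.Eventually.of_forall fun t => ?_)
  rw [Real.norm_eq_abs, abs_pow]
  exact pow_le_pow_left₀ (abs_nonneg _) (hC t) 2

/-- `I(F₀)` is the integral of `F0²` over the simplex `S·R₄₂` (the paper's domain of integration):
`F0` vanishes off the simplex. -/
theorem Ival_eq_setIntegral : Ival = ∫ t in scaledSimplex 42 Sc, F0 t ^ 2 := by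
  unfold Ival
  rw [setIntegral_eq_integral_of_forall_compl_eq_zero fun t ht => by
    simp [F0_eq_zero_of_not_mem ht]]

/-- The map `(t', s) ↦ (s, t') ∈ ℝ⁴²` is continuous. -/
theorem continuous_consMap :
    Continuous fun p : (Fin 41 → ℝ) × ℝ => (Fin.cons p.2 p.1 : Fin 42 → ℝ) :=
  Continuous.finCons continuous_snd continuous_fst

/-- If the section point `(s, t')` lies in `S·R₄₂` then `s ∈ [0, S]`. -/
theorem mem_Icc_of_cons_mem {s : ℝ} {t' : Fin 41 → ℝ}
    (h : (Fin.cons s t' : Fin 42 → ℝ) ∈ scaledSimplex 42 Sc) : s ∈ Icc 0 Sc := by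
  simpa using apply_mem_Icc_of_mem_scaledSimplex h 0

/-- `F₀(s, t') = 0` when the first coordinate `s` lies outside `[0, S]`. -/
theorem F0_cons_eq_zero {s : ℝ} {t' : Fin 41 → ℝ} (hs : s ∉ Icc 0 Sc) :
    F0 (Fin.cons s t') = 0 :=
  F0_eq_zero_of_not_mem fun h => hs (mem_Icc_of_cons_mem h)

/-- Every section `s ↦ F0 (s, t')` is integrable on `ℝ` (so `F0marg t'` is a genuine integral). -/
theorem integrable_F0_cons (t' : Fin 41 → ℝ) : Integrable fun s : ℝ => F0 (Fin.cons s t') := by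
  obtain ⟨C, -, hC⟩ := exists_bound_F0
  have hmeas : Measurable fun s : ℝ => F0 (Fin.cons s t') :=
    measurable_F0.comp (Continuous.finCons continuous_id continuous_const).measurable
  have hsupp : Function.support (fun s : ℝ => F0 (Fin.cons s t')) ⊆ Icc 0 Sc :=
    Function.support_subset_iff'.2 fun s hs => F0_cons_eq_zero hs
  rw [← integrableOn_iff_integrable_of_support_subset hsupp]
  exact Measure.integrableOn_of_bounded (M := C) measure_Icc_lt_top.ne hmeas.aestronglyMeasurable
    (Filter.Eventually.of_forall fun s => by simpa [Real.norm_eq_abs] using hC _)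

/-- The marginal `F0marg` is strongly measurable (Fubini integrand measurability). -/
theorem stronglyMeasurable_F0marg : StronglyMeasurable F0marg := by
  have h : StronglyMeasurable
      (Function.uncurry fun (t' : Fin 41 → ℝ) (s : ℝ) => F0 (Fin.cons s t')) :=
    (measurable_F0.comp continuous_consMap.measurable).stronglyMeasurable
  exact h.integral_prod_right

/-- The marginal `F0marg = (F₀)₁` is measurable. -/
theorem measurable_F0marg : Measurable F0marg := stronglyMeasurable_F0marg.measurable

/-- `0 < S` (`S = 209/200`), type-ascribed: `FordP1.Sc_pos` (`Sc : ℕ`) is an unrelated homonym. -/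
theorem Sc_pos : (0 : ℝ) < Dhl42.Sc := by unfold Sc eps; norm_num

/-- The marginal is bounded: `|F0marg t'| ≤ C·S`. -/
theorem exists_bound_F0marg : ∃ C : ℝ, 0 ≤ C ∧ ∀ t', |F0marg t'| ≤ C := by
  obtain ⟨C, hC0, hC⟩ := exists_bound_F0
  refine ⟨C * Sc, mul_nonneg hC0 Sc_pos.le, fun t' => ?_⟩
  have h1 : F0marg t' = ∫ s in Icc 0 Sc, F0 (Fin.cons s t') := by
    unfold F0marg
    rw [setIntegral_eq_integral_of_forall_compl_eq_zero fun s hs => F0_cons_eq_zero hs]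
  rw [h1, ← Real.norm_eq_abs]
  calc ‖∫ s in Icc 0 Sc, F0 (Fin.cons s t')‖
      ≤ C * volume.real (Icc 0 Sc) :=
        norm_setIntegral_le_of_norm_le_const measure_Icc_lt_top fun s _ => by
          simpa [Real.norm_eq_abs] using hC _
    _ = C * Sc := by rw [Real.volume_real_Icc_of_le Sc_pos.le, sub_zero]

/-- `F0marg²` is integrable on every set of finite measure. -/
theorem integrableOn_F0marg_sq {A : Set (Fin 41 → ℝ)} (hA : volume A ≠ ⊤) :
    IntegrableOn (fun t' => F0marg t' ^ 2) A := by
  obtain ⟨C, -, hC⟩ := exists_bound_F0marg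
  refine Measure.integrableOn_of_bounded (M := C ^ 2) hA
    (measurable_F0marg.pow_const 2).aestronglyMeasurable (Filter.Eventually.of_forall fun t' => ?_)
  rw [Real.norm_eq_abs, abs_pow]
  exact pow_le_pow_left₀ (abs_nonneg _) (hC t') 2

/-- The integrand of `JKval` is integrable on `K·R₄₁`. -/
theorem integrableOn_JKval : IntegrableOn (fun t' => F0marg t' ^ 2) (scaledSimplex 41 Kc) :=
  integrableOn_F0marg_sq (volume_scaledSimplex_lt_top 41 Kc).ne

/-- The integrand of `LGval` is integrable on `K·R₄₁ \ Ω'`. -/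
theorem integrableOn_LGval : IntegrableOn (fun t' => F0marg t' ^ 2) (scaledSimplex 41 Kc \ OmegaG) :=
  integrableOn_F0marg_sq
    (lt_of_le_of_lt (measure_mono fun _ ht => ht.1) (volume_scaledSimplex_lt_top 41 Kc)).ne

end

end Summit.Parity.GeneralizedHardyLittlewood.Theorems.Dhl42
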